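import Literature.Analysis.FunctionSpaces.TorusSpaceTimeL3Cauchy
import HarnessLib

/-!
# Stub `stub_krMollifyError` (H4) of the plan for `stub_kolmogorovRieszPeriodicSlab`
(line `tight`, crux `EulerLimit.EulerlimitThesisV2`, stmt-AnomalousDissipation-0511)

**Time-integrated CET (6).**  For a field `w` jointly smooth on the open strip `(0,T) × T^d` and
the standard torus mollifier `ρ_ε = Torus.kernel ε` (`0 < ε ≤ 1/4`), the space–time `L³`
mollification error is bounded by the SPACE translation modulus at scale `ε`:

  `∫₀ᵀ∫ ‖ρ_ε ⋆ w(t) - w(t)‖³ dx dt ≤ sup_{‖y‖ ≤ ε} ∫₀ᵀ∫ ‖w(t, · - y) - w(t, ·)‖³ dx dt`.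

The slice-wise estimate `Torus.eLpNorm_kernel_convolution_sub_self_le` (Constantin–E–Titi 1994,
(6)) gives the wrong order `∫_t sup_y`; here the Minkowski–Jensen inequality
`Literature.Analysis.FunctionSpaces.lintegral_rpow_enorm_integral_smul_le` is applied on the
product space `X = (0,T) × T^d` directly (`(ρ_ε ⋆ w(t))(x) - w(t,x) = ∫ ρ_ε(y) (w(t,x-y) - w(t,x)) dy`,
joint measurability of `((t,x),y) ↦ w(t,x-y) - w(t,x)` through the quasi-measure-preserving shear
`((t,x),y) ↦ (t,x-y)`).  Generic in the torus index `d` and the (complete) value space; the file ends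
with the REGISTERED sub-stub `stub_krMollifyError` (`d = Fin 3`, values in `ℝ³`), signature verbatim.
-/

noncomputable section

-- D-0017: single-problem summit ⇒ the duplicated namespace segment is by design.
set_option linter.dupNamespace false

open MeasureTheory Set Function Filter
open scoped ENNReal Topology Convolution

namespace Summit.AnomalousDissipation.AnomalousDissipation.Theorems.EulerLimitKR

open Literature.Analysis.FunctionSpaces Literature.Analysis.FunctionSpaces.Torus

/-- **Time-integrated CET (6) (H4): the `L³((0,T) × T^d)` mollification error is bounded by the
space translation modulus.**  If `w` is jointly smooth on `(0,T) × T^d` (`T > 0`),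
`0 < ε ≤ 1/4`, and `∫₀ᵀ∫ ‖w(t, x - y) - w(t, x)‖³ dx dt ≤ Λ` for all `‖y‖ ≤ ε`, then
`∫₀ᵀ∫ ‖(ρ_ε ⋆ w(t))(x) - w(t,x)‖³ dx dt ≤ Λ` (Minkowski–Jensen on `(0,T) × T^d` against the unit-mass
kernel `ρ_ε`, supported in `B(0, ε)`). [cite: ConstantinETiti1994, (6)] -/
theorem lintegral_lintegral_kernel_convolution_sub_self_le
    {d : Type*} [Fintype d] {F' : Type*} [NormedAddCommGroup F'] [NormedSpace ℝ F']
    [CompleteSpace F'] {T : ℝ} (hT : 0 < T) {w : ℝ → UnitAddTorus d → F'}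
    (hw : IsSmoothSpaceTimeOn (Ioo 0 T) w) {ε : ℝ} (hε : 0 < ε) (hε' : ε ≤ 1 / 4) {Λ : ℝ≥0∞}
    (hmod : ∀ y : UnitAddTorus d, ‖y‖ ≤ ε →
      ∫⁻ t in Ioo 0 T, ∫⁻ x, ‖w t (x - y) - w t x‖ₑ ^ 3 ≤ Λ) :
    ∫⁻ t in Ioo 0 T, ∫⁻ x, ‖(kernel ε ⋆ w t) x - w t x‖ₑ ^ 3 ≤ Λ := by
  set μT : Measure (ℝ × UnitAddTorus d) := (volume.restrict (Ioo 0 T)).prod volume with hμT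
  have hk : Continuous (kernel (d := d) ε) := continuous_kernel hε hε'
  have hkint : Integrable (kernel (d := d) ε) volume := hk.integrable_unitAddTorus
  -- joint measurability of `w` and of its mollification
  have hWm : AEStronglyMeasurable (uncurry w) μT := hw.aestronglyMeasurable_uncurry_prod
  have hKst : IsSmoothSpaceTimeOn (Ioo 0 T) (fun t => kernel ε ⋆ w t) :=
    hw.convolution hkint (convex_Ioo 0 T) (by rw [interior_Ioo]; exact nonempty_Ioo.2 hT)
  have hKm : AEStronglyMeasurable (uncurry fun t => kernel ε ⋆ w t) μT :=
    hKst.aestronglyMeasurable_uncurry_prod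
  -- the kernel average of differences
  set Φ : ℝ × UnitAddTorus d → UnitAddTorus d → F' := fun p y => w p.1 (p.2 - y) - w p.1 p.2 with hΦ
  -- the shear `((t, x), y) ↦ (t, x - y)` is quasi measure preserving `μT ⊗ vol → μT`
  have hΨ : Measure.QuasiMeasurePreserving
      (fun z : (ℝ × UnitAddTorus d) × UnitAddTorus d => (z.1.1, z.1.2 - z.2)) (μT.prod volume) μT := by
    have h1 : Measure.QuasiMeasurePreserving
        (Prod.map id (fun q : UnitAddTorus d × UnitAddTorus d => q.1 - q.2))
        ((volume.restrict (Ioo 0 T)).prod ((volume : Measure (UnitAddTorus d)).prod volume)) μT :=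
      MeasureTheory.QuasiMeasurePreserving.prodMap (Measure.QuasiMeasurePreserving.id _)
        (quasiMeasurePreserving_sub_of_right_invariant volume volume)
    have h2 : MeasurePreserving (MeasurableEquiv.prodAssoc : (ℝ × UnitAddTorus d) × UnitAddTorus d ≃ᵐ
        ℝ × UnitAddTorus d × UnitAddTorus d) (μT.prod volume)
        ((volume.restrict (Ioo 0 T)).prod ((volume : Measure (UnitAddTorus d)).prod volume)) :=
      measurePreserving_prodAssoc _ _ _
    have h3 := h1.comp h2.quasiMeasurePreserving
    refine (congrArg (fun f => Measure.QuasiMeasurePreserving f (μT.prod volume) μT) ?_).mp h3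
    funext z
    rfl
  have hΦm : AEStronglyMeasurable (uncurry Φ) (μT.prod volume) :=
    (hWm.comp_quasiMeasurePreserving hΨ).sub hWm.comp_fst
  -- Step 1: rewrite the mollification error as a kernel average, in product form
  have hslice : ∀ t ∈ Ioo 0 T, IsSmooth (w t) := fun t ht => hw.isSmooth_slice ht
  have hpt : ∀ t ∈ Ioo 0 T, ∀ x, (kernel ε ⋆ w t) x - w t x = ∫ y, kernel ε y • Φ (t, x) y :=
    fun t ht x => kernel_convolution_sub_self_apply (hslice t ht).integrable hε hε' x
  have hae : ∀ᵐ p ∂μT, (kernel ε ⋆ w p.1) p.2 - w p.1 p.2 = ∫ y, kernel ε y • Φ p y := by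
    have h1 : ∀ᵐ p ∂μT, p.1 ∈ Ioo 0 T :=
      (Measure.quasiMeasurePreserving_fst (μ := volume.restrict (Ioo 0 T))
        (ν := (volume : Measure (UnitAddTorus d)))).ae (ae_restrict_mem measurableSet_Ioo)
    filter_upwards [h1] with p hp
    exact hpt p.1 hp p.2
  have hdiffm : AEMeasurable (fun p : ℝ × UnitAddTorus d => ‖(kernel ε ⋆ w p.1) p.2 - w p.1 p.2‖ₑ ^ 3) μT :=
    ((hKm.sub hWm).enorm.pow_const 3 :)
  have hLHS : ∫⁻ t in Ioo 0 T, ∫⁻ x, ‖(kernel ε ⋆ w t) x - w t x‖ₑ ^ 3 =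
      ∫⁻ p, ‖∫ y, kernel ε y • Φ p y‖ₑ ^ (3 : ℝ) ∂μT := by
    rw [← lintegral_prod _ hdiffm]
    refine lintegral_congr_ae ?_
    filter_upwards [hae] with p hp
    rw [hp, show (3 : ℝ) = ((3 : ℕ) : ℝ) by norm_num, ENNReal.rpow_natCast]
  -- Step 2: the Minkowski–Jensen bound on the product space
  have hB : ∀ᵐ y ∂(volume : Measure (UnitAddTorus d)), kernel ε y ≠ 0 →
      ∫⁻ p, ‖Φ p y‖ₑ ^ (3 : ℝ) ∂μT ≤ Λ := by
    refine ae_of_all _ fun y hy => ?_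
    have hyε : ‖y‖ ≤ ε := (mem_ball_zero_iff.1 (support_kernel_subset hε hy)).le
    have hΦy : AEMeasurable (fun p : ℝ × UnitAddTorus d => ‖Φ p y‖ₑ ^ 3) μT := by
      have hsh : Measure.QuasiMeasurePreserving
          (fun p : ℝ × UnitAddTorus d => (p.1, p.2 - y)) μT μT := by
        have h := MeasureTheory.QuasiMeasurePreserving.prodMap
          (Measure.QuasiMeasurePreserving.id (volume.restrict (Ioo 0 T)))
          (measurePreserving_sub_right (volume : Measure (UnitAddTorus d)) y).quasiMeasurePreserving
        exact h
      exact (((hWm.comp_quasiMeasurePreserving hsh).sub hWm).enorm.pow_const 3 :)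
    calc ∫⁻ p, ‖Φ p y‖ₑ ^ (3 : ℝ) ∂μT = ∫⁻ p, ‖Φ p y‖ₑ ^ 3 ∂μT := by
          refine lintegral_congr fun p => ?_
          rw [show (3 : ℝ) = ((3 : ℕ) : ℝ) by norm_num, ENNReal.rpow_natCast]
      _ = ∫⁻ t in Ioo 0 T, ∫⁻ x, ‖w t (x - y) - w t x‖ₑ ^ 3 := lintegral_prod _ hΦy
      _ ≤ Λ := hmod y hyε
  have hMJ := lintegral_rpow_enorm_integral_smul_le (μ := μT) hk.aestronglyMeasurable hΦm
    (by norm_num : (1 : ℝ) ≤ 3) hB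
  rw [lintegral_enorm_kernel hε hε', ENNReal.one_rpow, one_mul] at hMJ
  rw [hLHS]
  exact hMJ

/-- **Registered sub-stub `stub_krMollifyError`** (H4 of the STUB-PLAN for
`stub_kolmogorovRieszPeriodicSlab`, `d = Fin 3`): the time-integrated mollification error is at
most the space `L³`-modulus (`lintegral_lintegral_kernel_convolution_sub_self_le`; the convolution
is spelled out as `MeasureTheory.convolution (kernel ε) (w t) (lsmul ℝ ℝ) volume x`,
definitionally `(kernel ε ⋆ w t) x`). [cite: ConstantinETiti1994, (6)] -/
theorem stub_krMollifyError :
    ∀ (T : ℝ) (w : ℝ → UnitAddTorus (Fin 3) → EuclideanSpace ℝ (Fin 3)) (ε : ℝ) (Λ : ENNReal), 0 < T → Literature.Analysis.FunctionSpaces.Torus.IsSmoothSpaceTimeOn (Set.Ioo 0 T) w → 0 < ε → ε ≤ 1 / 4 → (∀ y : UnitAddTorus (Fin 3), ‖y‖ ≤ ε → ∫⁻ t in Set.Ioo 0 T, ∫⁻ x, ‖w t (x - y) - w t x‖ₑ ^ 3 ≤ Λ) → ∫⁻ t in Set.Ioo 0 T, ∫⁻ x, ‖MeasureTheory.convolution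 (Literature.Analysis.FunctionSpaces.Torus.kernel ε) (w t) (ContinuousLinearMap.lsmul ℝ ℝ) MeasureTheory.volume x - w t x‖ₑ ^ 3 ≤ Λ :=
  fun _T _w _ε _Λ hT hw hε hε' hmod => lintegral_lintegral_kernel_convolution_sub_self_le hT hw hε hε' hmod

end Summit.AnomalousDissipation.AnomalousDissipation.Theorems.EulerLimitKR

end
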